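import Literature.NumberTheory.LFunctions.FordLargeLambda
import Literature.NumberTheory.LFunctions.FordLargeLambdaTail
import Literature.NumberTheory.LFunctions.FordExpSumMidLambda
import HarnessLib

/-!
# Ford's Theorem 2 for `λ ≥ 87` and Theorem 1 reduced to Theorems 3–4

Topic `Literature/NumberTheory/LFunctions`. Pure proof file. K. Ford, Proc. LMS 85 (2002):

* `FordVK.expSum_bound_lambda_ge_87` — **Theorem 2 for `t ≥ N^{87}`** (constant `9.463`,
  `B = 1/133.66`): the certified rows `87 ≤ λ ≤ 2025` (`FordVK.expSum_bound_lambda_87_2025`,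
  `FordLargeLambda.lean`) and the tail `λ ≥ 2025` (`FordVK.Tail.expSum_bound_lambda_ge_2025'`,
  `FordLargeLambdaTail.lean`), both from the rows of (1.7) (hypotheses `hT3a`–`hT3c` = Theorem 3 of
  the source for `k ≥ 129`) and Theorem 4 of the source (hypothesis `hT4`, verbatim);
* `zeta_bound_ford_of_theorem3_theorem4` — **Ford's Theorem 1**
  (`Literature.NumberTheory.LFunctions.zeta_bound_ford`: `|ζ(σ+it)| ≤ 76.2 t^{4.45(1−σ)^{3/2}} log^{2/3} t`)
  **follows from Theorems 3 and 4 of the source alone**, via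
  `zeta_bound_ford_of_exp_sum_bound13_lambda_gt_87` (`FordExpSumMidLambda.lean`: the ranges
  `λ ≤ 8` by van der Corput and `8 ≤ λ ≤ 87` by the certified rows of Table 6.1 are in the tree).

What remains for `zeta_bound_ford` itself are the explicit Vinogradov mean value theorems of
§§3–4 of the source: the three rows of (1.7) used here (Theorem 3 for `129 ≤ k ≤ 149`,
`150 ≤ k ≤ 199`, `k ≥ 200`) and Theorem 4 (incomplete systems).

## References
* K. Ford, Proc. London Math. Soc. (3) 85 (2002), 565–633; arXiv:1910.08209: Theorems 1–4, (1.7),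
  §5 (Lemmas 5.2–5.3), §7. [Ford2002]
-/

noncomputable section

open Finset

namespace Literature.NumberTheory.LFunctions

namespace FordVK

/-- **Theorem 2 of [Ford2002] for `t ≥ N^{87}`** (i.e. `λ = log t/log N ≥ 87`), from the rows of
(1.7) with `k ≥ 129` (Theorem 3) and Theorem 4 of the source: for `1 ≤ N < R₀ ≤ 2N`, `0 < u ≤ 1`,
`|∑_{N<n≤R₀} (n+u)^{-it}| ≤ 9.463 · N^{1 − log²N/(133.66 log²t)}`.
[cite: Ford2002, Theorem 2 with §5, Lemmas 5.2–5.3] -/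
theorem expSum_bound_lambda_ge_87
    (hT3a : ∀ k : ℕ, 200 ≤ k → ∃ s₃ : ℕ, 1 ≤ s₃ ∧ (s₃ : ℝ) ≤ 3.21432 * (k : ℝ) ^ 2 ∧ ∀ P : ℕ, 1 ≤ P →
      (VMV.J k s₃ (Finset.Icc (1 : ℤ) P) : ℝ) ≤ (k : ℝ) ^ (2.3291 * (k : ℝ) ^ 3)
        * (P : ℝ) ^ ((2 * s₃ : ℝ) - ((k * (k + 1) / 2 : ℕ) : ℝ) + 0.001 * (k : ℝ) ^ 2))
    (hT3b : ∀ k : ℕ, 150 ≤ k → k ≤ 199 → ∃ s₃ : ℕ, 1 ≤ s₃ ∧ (s₃ : ℝ) ≤ 3.21734 * (k : ℝ) ^ 2 ∧ ∀ P : ℕ, 1 ≤ P →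
      (VMV.J k s₃ (Finset.Icc (1 : ℤ) P) : ℝ) ≤ (k : ℝ) ^ (2.3849 * (k : ℝ) ^ 3)
        * (P : ℝ) ^ ((2 * s₃ : ℝ) - ((k * (k + 1) / 2 : ℕ) : ℝ) + 0.001 * (k : ℝ) ^ 2))
    (hT3c : ∀ k : ℕ, 129 ≤ k → k ≤ 149 → ∃ s₃ : ℕ, 1 ≤ s₃ ∧ (s₃ : ℝ) ≤ 3.22313 * (k : ℝ) ^ 2 ∧ ∀ P : ℕ, 1 ≤ P →
      (VMV.J k s₃ (Finset.Icc (1 : ℤ) P) : ℝ) ≤ (k : ℝ) ^ (2.4183 * (k : ℝ) ^ 3)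
        * (P : ℝ) ^ ((2 * s₃ : ℝ) - ((k * (k + 1) / 2 : ℕ) : ℝ) + 0.001 * (k : ℝ) ^ 2))
    (hT4 : ∀ (k h s : ℕ) (P η D : ℝ), 60 ≤ k → (0.9 : ℝ) * k ≤ h → h + 2 ≤ k →
      2 * (k - h + 1) ≤ s → s ≤ (h / 2) * (k - h + 1) → 10 ≤ D → Real.exp (D * (k : ℝ) ^ 2) ≤ P →
      2 / (k : ℝ) ^ 3 < η → η ≤ 1 / (2 * (k : ℝ)) →
      18 / (k : ℝ) ≤ 4 * Real.log k / (D * (k : ℝ) ^ 2 * η) →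
      4 * Real.log k / (D * (k : ℝ) ^ 2 * η) ≤ 0.4 →
      (Jinc k s ((calC P (P ^ η)).map Nat.castEmbedding) h k : ℝ)
        ≤ Real.exp ((s : ℝ) ^ 2 / ((k : ℝ) - h + 1)
            + 10.5 * ((k : ℝ) - h + 1) * Real.log k ^ 2 / (D * k * η ^ 2)
            - s * ((1 / η + h) * (1 - 1 / (h : ℝ)) ^ ((s : ℝ) / ((k : ℝ) - h + 1)) - h)
              * Real.log (1 / (10 * η)))
          * P ^ ((2 * s : ℝ) - ((k : ℝ) - h + 1) / 2 * (h + k) + ((k : ℝ) - h + 1) * ((k : ℝ) - h) / 2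
            + η * (s : ℝ) ^ 2 / (2 * ((k : ℝ) - h + 1))
            + h * ((k : ℝ) - h + 1) * Real.exp (-(s : ℝ) / (h * ((k : ℝ) - h + 1)))))
    {N R₀ : ℕ} {t u : ℝ} (hN : 1 ≤ N) (hNR : N < R₀) (hR : R₀ ≤ 2 * N) (hu0 : 0 < u) (hu1 : u ≤ 1)
    (ht1 : (N : ℝ) ^ (87 : ℕ) ≤ t) :
    ‖∑ n ∈ Ioc N R₀, ((n : ℂ) + u) ^ (-(t * Complex.I))‖
      ≤ 9.463 * (N : ℝ) ^ (1 - Real.log N ^ 2 / (133.66 * Real.log t ^ 2)) := by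
  rcases le_or_gt t ((N : ℝ) ^ (2025 : ℕ)) with h | h
  · exact expSum_bound_lambda_87_2025 hT3a hT3b hT3c hT4 hN hNR hR hu0 hu1 ht1 h
  · exact Tail.expSum_bound_lambda_ge_2025' hT3a hT4 hN hNR hR hu0 hu1 h.le

end FordVK

/-- **Ford's Theorem 1 from Theorems 3 and 4 of the source.** `zeta_bound_ford`
(`|ζ(σ+it)| ≤ 76.2 t^{4.45(1−σ)^{3/2}} log^{2/3} t` for `1/2 ≤ σ ≤ 1`, `t ≥ 3`) follows from the rows
`k ≥ 129` of (1.7) (Theorem 3) and Theorem 4 of [Ford2002]; all other ingredients (§§2, 5–7, the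
certified Table 6.1, and the van der Corput range) are theorems of the tree.
[cite: Ford2002, Theorem 1 (proof, §7), Theorem 2 (§§5–6)] -/
theorem zeta_bound_ford_of_theorem3_theorem4
    (hT3a : ∀ k : ℕ, 200 ≤ k → ∃ s₃ : ℕ, 1 ≤ s₃ ∧ (s₃ : ℝ) ≤ 3.21432 * (k : ℝ) ^ 2 ∧ ∀ P : ℕ, 1 ≤ P →
      (VMV.J k s₃ (Finset.Icc (1 : ℤ) P) : ℝ) ≤ (k : ℝ) ^ (2.3291 * (k : ℝ) ^ 3)
        * (P : ℝ) ^ ((2 * s₃ : ℝ) - ((k * (k + 1) / 2 : ℕ) : ℝ) + 0.001 * (k : ℝ) ^ 2))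
    (hT3b : ∀ k : ℕ, 150 ≤ k → k ≤ 199 → ∃ s₃ : ℕ, 1 ≤ s₃ ∧ (s₃ : ℝ) ≤ 3.21734 * (k : ℝ) ^ 2 ∧ ∀ P : ℕ, 1 ≤ P →
      (VMV.J k s₃ (Finset.Icc (1 : ℤ) P) : ℝ) ≤ (k : ℝ) ^ (2.3849 * (k : ℝ) ^ 3)
        * (P : ℝ) ^ ((2 * s₃ : ℝ) - ((k * (k + 1) / 2 : ℕ) : ℝ) + 0.001 * (k : ℝ) ^ 2))
    (hT3c : ∀ k : ℕ, 129 ≤ k → k ≤ 149 → ∃ s₃ : ℕ, 1 ≤ s₃ ∧ (s₃ : ℝ) ≤ 3.22313 * (k : ℝ) ^ 2 ∧ ∀ P : ℕ, 1 ≤ P →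
      (VMV.J k s₃ (Finset.Icc (1 : ℤ) P) : ℝ) ≤ (k : ℝ) ^ (2.4183 * (k : ℝ) ^ 3)
        * (P : ℝ) ^ ((2 * s₃ : ℝ) - ((k * (k + 1) / 2 : ℕ) : ℝ) + 0.001 * (k : ℝ) ^ 2))
    (hT4 : ∀ (k h s : ℕ) (P η D : ℝ), 60 ≤ k → (0.9 : ℝ) * k ≤ h → h + 2 ≤ k →
      2 * (k - h + 1) ≤ s → s ≤ (h / 2) * (k - h + 1) → 10 ≤ D → Real.exp (D * (k : ℝ) ^ 2) ≤ P →
      2 / (k : ℝ) ^ 3 < η → η ≤ 1 / (2 * (k : ℝ)) →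
      18 / (k : ℝ) ≤ 4 * Real.log k / (D * (k : ℝ) ^ 2 * η) →
      4 * Real.log k / (D * (k : ℝ) ^ 2 * η) ≤ 0.4 →
      (FordVK.Jinc k s ((FordVK.calC P (P ^ η)).map Nat.castEmbedding) h k : ℝ)
        ≤ Real.exp ((s : ℝ) ^ 2 / ((k : ℝ) - h + 1)
            + 10.5 * ((k : ℝ) - h + 1) * Real.log k ^ 2 / (D * k * η ^ 2)
            - s * ((1 / η + h) * (1 - 1 / (h : ℝ)) ^ ((s : ℝ) / ((k : ℝ) - h + 1)) - h)
              * Real.log (1 / (10 * η)))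
          * P ^ ((2 * s : ℝ) - ((k : ℝ) - h + 1) / 2 * (h + k) + ((k : ℝ) - h + 1) * ((k : ℝ) - h) / 2
            + η * (s : ℝ) ^ 2 / (2 * ((k : ℝ) - h + 1))
            + h * ((k : ℝ) - h + 1) * Real.exp (-(s : ℝ) / (h * ((k : ℝ) - h + 1))))) :
    zeta_bound_ford :=
  zeta_bound_ford_of_exp_sum_bound13_lambda_gt_87 fun N R t u hN hNt hu0 hu1 hNR hR =>
    (FordVK.expSum_bound_lambda_ge_87 hT3a hT3b hT3c hT4 hN hNR hR hu0 hu1 hNt).trans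
      (mul_le_mul_of_nonneg_right (by norm_num) (by positivity))

end Literature.NumberTheory.LFunctions
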